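import Literature.Computability.MetaComplexity.RefutationCNF
import Literature.Computability.MetaComplexity.RefutationCNFSize
import HarnessLib

/-!
# Atserias–Müller, Theorem 2: hardness of the gadget `G(F) = RREF(F, 13n²)` from the two bounds

[Atserias–Müller 2020, §6, proof of Thm 2] derives Theorem 2 (a)+(b) — the named fact
`rrefGadget_hardness` of `RefutationCNF.lean` — from the upper bound [AM20, Lemma 11]
(`rrefCNF_upperBound`) and the lower bound [AM20, Lemma 10] (`rrefCNF_lowerBound`) in a few lines:
"It suffices to define `G` on 3-CNF formulas `F` with a sufficiently large number of variables `n`.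
Note `m ≤ 8n³` for `m` the number of clauses of `F`. We set `G(F) := RREF(F, 13n²)`. Note `G(F)`
has size between `n^{1/q}` and `n^q` for some constant `q > 0`. Thus, (a) follows from the first
statement of Lemma 11 for some constant `c > 0`, and (b) follows from Lemma 10 for `w := n` and
some constant `d > 0` (note that `20 ≤ w ≤ 2ⁿ/(13n)` for sufficiently large `n`)."

This file formalizes exactly this derivation (`rrefGadget_hardness_of_bounds`; the variant
`rrefGadget_hardness_of_bounds'` keeps the threshold `w₀` and the exponent `e` of the lower bound
abstract, [AM20, Lemma 10] being `w₀ = 20`, `e = 2/5`), with the size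
estimates `n ≤ |G(F)| ≤ 100·25⁵·n¹⁵` (`card_vars_le_size_rrefGadget`, `size_rrefGadget_le`, from
`RefutationCNFSize.lean`) in the role of `q`, and the
explicit constants `c := 13`, `d := 16`: if `π` is the refutation of Lemma 11, then
`|π| ≤ c₁ (13n²·n·m)² ≤ 10816 c₁ n¹² < n¹³ ≤ |G(F)|¹³` once `n > 10816 c₁`; and Lemma 10 with
`w := n` gives `|π| > 2^{e n} ≥ 2^{|G(F)|^{1/16}}` once `100·25⁵ ≤ e¹⁶ n`, since then
`|G(F)| ≤ 100·25⁵·n¹⁵ ≤ (e n)¹⁶` (`e = 2/5` for Lemma 10 as printed).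

The two lemmas themselves are the named facts `rrefCNF_upperBound`, `rrefCNF_lowerBound` of
`RefutationCNF.lean`; their discharges and the resulting `rrefGadget_hardness_holds` belong to the
sibling proof file `RefutationCNFProofs.lean` (which also discharges `rrefGadget_polyTime`); once
both are discharged, `rrefGadget_hardness` follows by `rrefGadget_hardness_of_bounds`.

## References

* A. Atserias, M. Müller, *Automating Resolution is NP-hard*, J. ACM 67(5) (2020), Art. 31;
  arXiv:1904.02991: Thm 2, §5 (Lemma 10, Lemma 11), §6 (proof of Thm 2).
-/

namespace Literature.Computability.MetaComplexity

open _root_.Computability Complexity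

/-- **Polynomial upper bound on the size of the gadget** `G(F) = RREF(F, 13n²)`: for a CNF `F`
of width `≤ 3` with `n ≥ 1` variables and `m ≤ 8n³` clauses, `|G(F)| ≤ 100 · 25⁵ · n¹⁵`.
[cite: AtseriasMuller2020, §6 (proof of Thm 2: "Note m ≤ 8n³ … G(F) has size … n^q")] -/
theorem size_rrefGadget_le {F : CNF ℕ} (hw : F.IsWidthLE 3)
    (hm : F.length ≤ 8 * (CNF.vars F).card ^ 3) (hn : 1 ≤ (CNF.vars F).card) :
    (rrefGadget F).size ≤ 100 * 25 ^ 5 * (CNF.vars F).card ^ 15 := by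
  set n := (CNF.vars F).card with hn_def
  have h1 : (rrefGadget F).size ≤ 100 * (13 * n ^ 2 + n + F.length + 3) ^ 5 := by
    rw [rrefGadget_eq, rrefCNF_eq, RefCNF.size_toNat, ← hn_def]
    have := RefCNF.size_rref_le (RefCNF.sortedVars F) hw (13 * n ^ 2)
    rwa [RefCNF.length_sortedVars, ← hn_def] at this
  have h2 : 13 * n ^ 2 + n + F.length + 3 ≤ 25 * n ^ 3 := by
    have h21 : n ^ 2 ≤ n ^ 3 := Nat.pow_le_pow_right hn (by norm_num)
    have h22 : n ≤ n ^ 3 := by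
      calc n = n ^ 1 := (pow_one n).symm
        _ ≤ n ^ 3 := Nat.pow_le_pow_right hn (by norm_num)
    have h23 : 1 ≤ n ^ 3 := Nat.one_le_pow _ _ hn
    omega
  calc (rrefGadget F).size ≤ 100 * (13 * n ^ 2 + n + F.length + 3) ^ 5 := h1
    _ ≤ 100 * (25 * n ^ 3) ^ 5 := Nat.mul_le_mul_left _ (Nat.pow_le_pow_left h2 5)
    _ = 100 * 25 ^ 5 * n ^ 15 := by ring

/-- **The gadget is at least as large as the number of variables**: `n ≤ |G(F)|` (indeed
`13n²(n+2) ≤ |G(F)|`). [cite: AtseriasMuller2020, §6 (proof of Thm 2: "G(F) has size between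
n^{1/q} and n^q")] -/
theorem card_vars_le_size_rrefGadget (F : CNF ℕ) : (CNF.vars F).card ≤ (rrefGadget F).size := by
  set n := (CNF.vars F).card with hn_def
  have h1 : 13 * n ^ 2 * (n + 2) ≤ (rrefGadget F).size := by
    rw [rrefGadget_eq, rrefCNF_eq, RefCNF.size_toNat, ← hn_def]
    have := RefCNF.le_size_rref (RefCNF.sortedVars F) F (13 * n ^ 2)
    rwa [RefCNF.length_sortedVars, ← hn_def] at this
  have h2 : n ≤ 13 * n ^ 2 * (n + 2) := by
    rcases Nat.eq_zero_or_pos n with h | h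
    · simp [h]
    · calc n = 1 * 1 * n := by ring
        _ ≤ 13 * n ^ 2 * (n + 2) := by
          apply Nat.mul_le_mul (Nat.mul_le_mul (by norm_num) (Nat.one_le_pow _ _ h)) (by omega)
  exact h2.trans h1

/-- A finite bound on the minimal refutation size is witnessed by a refutation of at most that
length (the `ℕ∞`-infimum over a nonempty set of naturals is attained below any upper bound).
[Krajíček 2019, §5.1 (size `S_R`)] [folklore] -/
theorem exists_isResRefutation_of_minResRefutationSize_le {φ : CNF ℕ} {N : ℕ}
    (h : minResRefutationSize φ ≤ (N : ℕ∞)) :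
    ∃ π : List (ResLine ℕ), IsResRefutation φ π ∧ π.length ≤ N := by
  by_contra hcon
  push Not at hcon
  have hle : ((N + 1 : ℕ) : ℕ∞) ≤ minResRefutationSize φ :=
    le_iInf₂ fun π hπ => by exact_mod_cast hcon π hπ
  have := hle.trans h
  norm_cast at this
  omega

/-- The elementary estimate `13·n·n ≤ 2ⁿ` for `n ≥ 20` (so that `w := n` satisfies
`w ≤ 2ⁿ/(13n)` in [AM20, Lemma 10]). [cite: AtseriasMuller2020, §6 (proof of Thm 2: "note that
20 ≤ w ≤ 2^n/(13n) for sufficiently large n")] -/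
theorem thirteen_mul_mul_le_two_pow {n : ℕ} (hn : 20 ≤ n) : 13 * n * n ≤ 2 ^ n := by
  induction n, hn using Nat.le_induction with
  | base => norm_num
  | succ k hk ih =>
    have h1 : 26 * k + 13 ≤ 13 * k * k := by nlinarith
    calc 13 * (k + 1) * (k + 1) = 13 * k * k + (26 * k + 13) := by ring
      _ ≤ 13 * k * k + 13 * k * k := by omega
      _ ≤ 2 ^ k + 2 ^ k := Nat.add_le_add ih ih
      _ = 2 ^ (k + 1) := by ring

/-- A CNF with an occurring variable has a clause. [folklore] -/
theorem one_le_length_of_one_le_card_vars {F : CNF ℕ} (h : 1 ≤ (CNF.vars F).card) :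
    1 ≤ F.length := by
  rcases F with _ | ⟨C, F⟩
  · simp [CNF.vars] at h
  · simp

/-- The threshold arithmetic of part (b): if `K ≤ e¹⁶·n` and `r ≤ K·n¹⁵` then `r ≤ (e n)¹⁶`.
[folklore] -/
theorem natCast_le_pow_sixteen {K n r : ℕ} {e : ℝ} (hKn : (K : ℝ) ≤ e ^ 16 * n)
    (hr : r ≤ K * n ^ 15) : (r : ℝ) ≤ (e * (n : ℝ)) ^ 16 := by
  have h1 : (r : ℝ) ≤ (K : ℝ) * (n : ℝ) ^ 15 := by exact_mod_cast hr
  refine h1.trans ?_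
  have hn15 : (0 : ℝ) ≤ (n : ℝ) ^ 15 := by positivity
  calc (K : ℝ) * (n : ℝ) ^ 15 ≤ e ^ 16 * (n : ℝ) * (n : ℝ) ^ 15 := by gcongr
    _ = (e * (n : ℝ)) ^ 16 := by ring

/-- Taking sixteenth roots: `r ≤ q¹⁶` gives `r^{1/16} ≤ q` for `q ≥ 0`. [folklore] -/
theorem rpow_inv_sixteen_le {r : ℕ} {q : ℝ} (hq : 0 ≤ q) (h : (r : ℝ) ≤ q ^ 16) :
    (r : ℝ) ^ (1 / (16 : ℝ)) ≤ q := by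
  calc (r : ℝ) ^ (1 / (16 : ℝ)) ≤ (q ^ 16) ^ (1 / (16 : ℝ)) :=
        Real.rpow_le_rpow (by positivity) h (by norm_num)
    _ = q := by
        rw [show (1 / (16 : ℝ)) = ((16 : ℕ) : ℝ)⁻¹ by norm_num]
        exact Real.pow_rpow_inv_natCast hq (by norm_num)

/-- **Atserias–Müller, Theorem 2 (a)+(b) from Lemma 11 and a lower bound of the shape of
Lemma 10** [AM20, §6, proof of Thm 2], with the constants of the lower bound kept abstract: if
(Lemma 11) `rrefCNF_upperBound` holds and (Lemma 10-type bound) for some threshold `w₀` and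
exponent `e > 0`, for all large `n`, all `w₀ ≤ w` with `13nw ≤ 2ⁿ` and every unsatisfiable `F` with
`n` variables and non-tautological clauses every refutation of `RREF(F,13nw)` is longer than
`2^{e·w}`, then `rrefGadget_hardness` holds, with `c := 13`, `d := 16` and a threshold `n₀`
depending on `c₁, n₁, w₀, e`: for (a), a refutation of length
`≤ c₁(13n²·n·m)² ≤ 10816·c₁·n¹² < n¹³ ≤ |G(F)|¹³` (`m ≤ 8n³`, `n ≤ |G(F)|`, `n > 10816 c₁`); for (b),
the lower bound with `w := n` (`w₀, 20 ≤ n`, `13·n·n ≤ 2ⁿ`) gives length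
`> 2^{e n} ≥ 2^{|G(F)|^{1/16}}` as `|G(F)| ≤ 100·25⁵·n¹⁵ ≤ (e n)¹⁶` for `n ≥ 100·25⁵/e¹⁶`.
([AM20, Lemma 10] is the case `w₀ = 20`, `e = 2/5`; the abstraction makes the reduction
independent of these two constants.)
[cite: AtseriasMuller2020, Thm 2 (a)+(b) and §6 (proof of Thm 2 from Lemmas 10, 11)] -/
theorem rrefGadget_hardness_of_bounds' (hU : rrefCNF_upperBound) {w₀ : ℕ} {e : ℝ} (he : 0 < e)
    (hL : ∃ n₁ : ℕ, ∀ (n w : ℕ) (F : CNF ℕ), n₁ ≤ n → w₀ ≤ w → 13 * n * w ≤ 2 ^ n →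
      (CNF.vars F).card = n → (∀ C ∈ F.clauseFinsets, IsNonTaut C) → ¬ F.Satisfiable →
        ∀ π : List (ResLine ℕ), IsResRefutation (rrefCNF F (13 * n * w)) π →
          (2 : ℝ) ^ (e * w) < π.length) :
    rrefGadget_hardness := by
  obtain ⟨c₁, hc₁⟩ := hU
  obtain ⟨n₁, hn₁⟩ := hL
  refine ⟨13, 16, by norm_num, by norm_num, ?_⟩
  refine ⟨max (max n₁ (max w₀ 20))
    (max (10816 * c₁ + 1) (⌈((100 * 25 ^ 5 : ℕ) : ℝ) / e ^ 16⌉₊ + 1)), ?_⟩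
  intro F hw hnt hm hn0
  -- facts stated with `(CNF.vars F).card`, collected before naming it `n`
  have h20c : 20 ≤ (CNF.vars F).card :=
    le_trans (((le_max_right w₀ 20).trans (le_max_right n₁ _)).trans (le_max_left _ _)) hn0
  have hn1c : 1 ≤ (CNF.vars F).card := le_trans (by norm_num) h20c
  have hsize := size_rrefGadget_le hw hm hn1c
  have hsize_low := card_vars_le_size_rrefGadget F
  have hlen : 1 ≤ F.length := one_le_length_of_one_le_card_vars hn1c
  obtain ⟨n, hn_def⟩ : ∃ n, (CNF.vars F).card = n := ⟨_, rfl⟩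
  rw [hn_def] at hm hn0 hsize hsize_low h20c hn1c
  -- unpacking the threshold
  have hA : max n₁ (max w₀ 20) ≤ n := (le_max_left _ _).trans hn0
  have hB : max (10816 * c₁ + 1) (⌈((100 * 25 ^ 5 : ℕ) : ℝ) / e ^ 16⌉₊ + 1) ≤ n :=
    (le_max_right _ _).trans hn0
  have hn₁n : n₁ ≤ n := (le_max_left _ _).trans hA
  have hw₀n : w₀ ≤ n := ((le_max_left _ _).trans (le_max_right _ _)).trans hA
  have h20 : 20 ≤ n := ((le_max_right _ _).trans (le_max_right _ _)).trans hA
  have hc₁n : 10816 * c₁ + 1 ≤ n := (le_max_left _ _).trans hB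
  have hceil : ⌈((100 * 25 ^ 5 : ℕ) : ℝ) / e ^ 16⌉₊ + 1 ≤ n := (le_max_right _ _).trans hB
  have hKn : ((100 * 25 ^ 5 : ℕ) : ℝ) ≤ e ^ 16 * n := by
    have h1 := Nat.le_ceil (((100 * 25 ^ 5 : ℕ) : ℝ) / e ^ 16)
    have h2 : ((⌈((100 * 25 ^ 5 : ℕ) : ℝ) / e ^ 16⌉₊ : ℕ) : ℝ) ≤ n := by
      exact_mod_cast (by omega : ⌈((100 * 25 ^ 5 : ℕ) : ℝ) / e ^ 16⌉₊ ≤ n)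
    have h3 : ((100 * 25 ^ 5 : ℕ) : ℝ) / e ^ 16 ≤ n := h1.trans h2
    rw [div_le_iff₀ (by positivity)] at h3
    linarith
  constructor
  · -- (a): `F` satisfiable — the short refutation of Lemma 11 for `s = 13n²`
    intro hsat
    have hs1 : 1 ≤ 13 * (CNF.vars F).card ^ 2 :=
      le_trans (by norm_num) (Nat.mul_le_mul_left 13 (Nat.one_le_pow _ _ (hn_def ▸ hn1c)))
    have hbound := hc₁ F (13 * (CNF.vars F).card ^ 2) hs1 (hn_def ▸ hn1c) hlen hsat
    obtain ⟨π, hπ, hπlen⟩ := exists_isResRefutation_of_minResRefutationSize_le hbound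
    refine ⟨π, hπ, ?_⟩
    rw [hn_def] at hπlen
    have step1 : 13 * n ^ 2 * n * F.length ≤ 104 * n ^ 6 := by
      calc 13 * n ^ 2 * n * F.length ≤ 13 * n ^ 2 * n * (8 * n ^ 3) := Nat.mul_le_mul_left _ hm
        _ = 104 * n ^ 6 := by ring
    have step2 : c₁ * (13 * n ^ 2 * n * F.length) ^ 2 ≤ c₁ * 10816 * n ^ 12 := by
      calc c₁ * (13 * n ^ 2 * n * F.length) ^ 2 ≤ c₁ * (104 * n ^ 6) ^ 2 :=
            Nat.mul_le_mul_left _ (Nat.pow_le_pow_left step1 2)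
        _ = c₁ * 10816 * n ^ 12 := by ring
    have step3 : c₁ * 10816 * n ^ 12 < n ^ 13 := by
      have h1 : c₁ * 10816 < n := by omega
      calc c₁ * 10816 * n ^ 12 < n * n ^ 12 := Nat.mul_lt_mul_of_pos_right h1 (by positivity)
        _ = n ^ 13 := by ring
    have step4 : n ^ 13 ≤ (rrefGadget F).size ^ 13 := Nat.pow_le_pow_left hsize_low 13
    have hlt : π.length < (rrefGadget F).size ^ 13 :=
      lt_of_le_of_lt (hπlen.trans step2) (step3.trans_le step4)
    rw [show (13 : ℝ) = ((13 : ℕ) : ℝ) by norm_num, Real.rpow_natCast]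
    exact_mod_cast hlt
  · -- (b): `F` unsatisfiable — the lower bound with `w := n`
    intro hunsat π hπ
    have h132 : 13 * n * n ≤ 2 ^ n := thirteen_mul_mul_le_two_pow h20
    have hπ' : IsResRefutation (rrefCNF F (13 * n * n)) π := by
      rw [show 13 * n * n = 13 * (CNF.vars F).card ^ 2 by rw [hn_def]; ring]
      exact hπ
    have hlow := hn₁ n n F hn₁n hw₀n h132 hn_def hnt hunsat π hπ'
    refine lt_of_le_of_lt ?_ hlow
    apply Real.rpow_le_rpow_of_exponent_le (by norm_num : (1 : ℝ) ≤ 2)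
    exact rpow_inv_sixteen_le (by positivity) (natCast_le_pow_sixteen hKn hsize)

/-- **Atserias–Müller, Theorem 2 (a)+(b) from Lemmas 10 and 11** [AM20, §6, proof of Thm 2]:
the upper bound `rrefCNF_upperBound` [AM20, Lemma 11] and the lower bound `rrefCNF_lowerBound`
[AM20, Lemma 10] imply the hardness statement `rrefGadget_hardness` for the gadget
`G(F) = RREF(F, 13n²)` (the case `w₀ = 20`, `e = 2/5` of `rrefGadget_hardness_of_bounds'`).
[cite: AtseriasMuller2020, Thm 2 (a)+(b) and §6 (proof of Thm 2 from Lemmas 10, 11)] -/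
theorem rrefGadget_hardness_of_bounds (hU : rrefCNF_upperBound) (hL : rrefCNF_lowerBound) :
    rrefGadget_hardness := by
  obtain ⟨n₁, hn₁⟩ := hL
  refine rrefGadget_hardness_of_bounds' hU (w₀ := 20) (e := 2 / 5) (by norm_num) ⟨n₁, ?_⟩
  intro n w F h1 h2 h3 h4 h5 h6 π hπ
  have := hn₁ n w F h1 h2 h3 h4 h5 h6 π hπ
  rwa [show (2 : ℝ) * w / 5 = 2 / 5 * w by ring] at this

end Literature.Computability.MetaComplexity
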